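import Literature.MathematicalPhysics.QuantumManyBody.BoseGasFreeDirichletBEC
import Literature.MathematicalPhysics.QuantumManyBody.LiebYngvasonPoincare

/-!
# Crux `BoundaryTransferWeak` (stmt-AtomisticToContinuum-0827, routes `BECInsertionCorrector` /
# `BECPeriodicReduction`), line `Sketch` (coupled-bath-relocation): stub `stub_freeDirichletGap`

**S1 — the sharp free Dirichlet bound.** For every `C¹` bosonic Dirichlet trial state `Ψ` of
`N` particles in the box `Λ_L = (0,L)³`, `⟨Ψ, -ΔΨ⟩ = energy 0 Ψ ≥ 3N(π/L)²` (the free Dirichlet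
ground-state energy, `3π²/L²` per particle [LSSY2005, Ch. 2 (2.3)]). This is the calibration
input of the free class `v = 0` of the line (it feeds the identification of the free ground state,
stub S2b), and a reusable library inequality; the one-dimensional, one-line, one-axis and one-body
forms are exposed as public theorems.

Proof.
* `dirichlet_sq_mul_intervalIntegral_norm_sq_le` — the sharp Dirichlet Poincaré inequality on an
  interval, `(π/L)² ∫₀ᴸ ‖w‖² ≤ ∫₀ᴸ ‖w'‖²` for `w ∈ C¹` with `w(0) = w(L) = 0`: the quarter-period
  bound `Poincare.quarter_period_sq_mul_integral_le` (Riccati multiplier `-(π/L) cot`, file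
  `LiebYngvasonPoincare.lean`) on each half `[0, L/2]`, `[L/2, L]`;
  `dirichlet_lintegral_norm_sq_le` — its `ℝ≥0∞` form on the whole line for `w` vanishing off
  `(0, L)`.
* `dirichlet_lintegral_line_le` — along a coordinate line `t ↦ x₀ + t e_k` of `ℝ³` (chain rule);
  `lintegral_eq_lintegral_lintegral_insertNth` — Tonelli along the measure-preserving split
  `ℝ³ ≃ ℝ × ℝ²` at coordinate `k` (`MeasurableEquiv.toLp`, `MeasurableEquiv.piFinSuccAbove`);
  `dirichlet_lintegral_axis_le` — `(π/L)² ∫ |f|² ≤ ∫ |∂_k f|²` for `f ∈ C¹(ℝ³)` vanishing off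
  `Λ_L`; summed over the three axes: `dirichlet_lintegral_box_le`,
  `3(π/L)² ∫ |f|² ≤ ∫ |∇f|²`.
* `stub_freeDirichletGap` — Bose symmetry `T(Ψ) = N ∫ |∇₀Ψ|²`
  (`lintegral_kineticDensity_eq_mul`), slicing along the first particle
  (`lintegral_partialGradSq_zero_eq`, `lintegral_lintegral_vecCons`) and the one-body bound on
  each slice `x ↦ Ψ(x, Y)`, which is `C¹` and vanishes off `Λ_L`; `∫ |Ψ|² = 1`.

## References

* [LSSY2005] E. H. Lieb, R. Seiringer, J. P. Solovej, J. Yngvason, *The Mathematics of the Bose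
  Gas and its Condensation*, Oberwolfach Seminars 34, Birkhäuser 2005: Ch. 2, (2.3) ("the kinetic
  energy of a single particle in the ground state in the box is `3π²/ℓ²`").
-/

noncomputable section

namespace Summit.AtomisticToContinuum.BoseEinsteinCondensation.CoupledBaths

open Literature.MathematicalPhysics.QuantumManyBody.BoseGas MeasureTheory
open scoped ENNReal NNReal

/-! ### One dimension: the sharp Dirichlet Poincaré inequality on an interval -/

section OneDim

variable {E : Type*} [NormedAddCommGroup E] [InnerProductSpace ℝ E]

/-- **Sharp Dirichlet Poincaré inequality on an interval.** For `w ∈ C¹(ℝ; E)` with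
`w(0) = w(L) = 0`, `(π/L)² ∫₀ᴸ ‖w‖² ≤ ∫₀ᴸ ‖w'‖²` (the first Dirichlet eigenvalue `π²/L²` of
`-d²/dt²` on `(0, L)`): the quarter-period bound (Riccati multiplier) on each half `[0, L/2]`,
`[L/2, L]`. [folklore] -/
theorem dirichlet_sq_mul_intervalIntegral_norm_sq_le {L : ℝ} (hL : 0 < L) {w : ℝ → E}
    (hw : ContDiff ℝ 1 w) (h0 : w 0 = 0) (hwL : w L = 0) :
    (Real.pi / L) ^ 2 * ∫ t in (0 : ℝ)..L, ‖w t‖ ^ 2 ≤ ∫ t in (0 : ℝ)..L, ‖deriv w t‖ ^ 2 := by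
  have h1 := Poincare.quarter_period_sq_mul_integral_le (half_pos hL) hw (Or.inl h0)
  have h2 := Poincare.quarter_period_sq_mul_integral_le (by linarith : L / 2 < L) hw (Or.inr hwL)
  have e1 : Real.pi / (2 * (L / 2 - 0)) = Real.pi / L := by
    congr 1; ring
  have e2 : Real.pi / (2 * (L - L / 2)) = Real.pi / L := by
    congr 1; ring
  rw [e1] at h1
  rw [e2] at h2
  have hc1 : ∀ a b, IntervalIntegrable (fun t => ‖w t‖ ^ 2) volume a b := fun a b =>
    (hw.continuous.norm.pow 2).intervalIntegrable a b
  have hc2 : ∀ a b, IntervalIntegrable (fun t => ‖deriv w t‖ ^ 2) volume a b := fun a b =>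
    (hw.continuous_deriv_one.norm.pow 2).intervalIntegrable a b
  rw [← intervalIntegral.integral_add_adjacent_intervals (hc1 0 (L / 2)) (hc1 (L / 2) L),
    ← intervalIntegral.integral_add_adjacent_intervals (hc2 0 (L / 2)) (hc2 (L / 2) L), mul_add]
  exact add_le_add h1 h2

/-- **Sharp Dirichlet Poincaré inequality on an interval, `ℝ≥0∞` form on the line.** For
`w ∈ C¹(ℝ; E)` vanishing off `(0, L)`, `(π/L)² ∫_ℝ ‖w‖² ≤ ∫_ℝ ‖w'‖²` as lower Lebesgue
integrals. [folklore] -/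
theorem dirichlet_lintegral_norm_sq_le {L : ℝ} (hL : 0 < L) {w : ℝ → E} (hw : ContDiff ℝ 1 w)
    (hsupp : ∀ t ∉ Set.Ioo 0 L, w t = 0) :
    ENNReal.ofReal ((Real.pi / L) ^ 2) * ∫⁻ t, (‖w t‖₊ : ℝ≥0∞) ^ 2 ≤
      ∫⁻ t, (‖deriv w t‖₊ : ℝ≥0∞) ^ 2 := by
  have h0 : w 0 = 0 := hsupp 0 fun h => lt_irrefl _ h.1
  have hwL : w L = 0 := hsupp L fun h => lt_irrefl _ h.2
  have key := dirichlet_sq_mul_intervalIntegral_norm_sq_le hL hw h0 hwL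
  -- the left-hand side lives on `(0, L]`
  have hsub : Function.support (fun t => (‖w t‖₊ : ℝ≥0∞) ^ 2) ⊆ Set.Ioc 0 L := by
    intro t ht
    by_contra htc
    exact ht (by simp [hsupp t fun h => htc ⟨h.1, h.2.le⟩])
  have hi1 : IntegrableOn (fun t => ‖w t‖ ^ 2) (Set.Ioc 0 L) :=
    (hw.continuous.norm.pow 2).integrableOn_Ioc
  have hi2 : IntegrableOn (fun t => ‖deriv w t‖ ^ 2) (Set.Ioc 0 L) :=
    (hw.continuous_deriv_one.norm.pow 2).integrableOn_Ioc
  have hA : ∫⁻ t, (‖w t‖₊ : ℝ≥0∞) ^ 2 = ENNReal.ofReal (∫ t in (0 : ℝ)..L, ‖w t‖ ^ 2) := by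
    rw [← setLIntegral_eq_of_support_subset hsub, intervalIntegral.integral_of_le hL.le,
      ofReal_integral_eq_lintegral_ofReal hi1 (ae_of_all _ fun t => by positivity)]
    exact lintegral_congr fun t => (Poincare.ofReal_norm_sq _).symm
  have hB : ENNReal.ofReal (∫ t in (0 : ℝ)..L, ‖deriv w t‖ ^ 2) ≤
      ∫⁻ t, (‖deriv w t‖₊ : ℝ≥0∞) ^ 2 := by
    rw [intervalIntegral.integral_of_le hL.le,
      ofReal_integral_eq_lintegral_ofReal hi2 (ae_of_all _ fun t => by positivity)]
    calc ∫⁻ t in Set.Ioc 0 L, ENNReal.ofReal (‖deriv w t‖ ^ 2)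
        = ∫⁻ t in Set.Ioc 0 L, (‖deriv w t‖₊ : ℝ≥0∞) ^ 2 :=
          lintegral_congr fun t => Poincare.ofReal_norm_sq _
      _ ≤ _ := setLIntegral_le_lintegral _ _
  calc ENNReal.ofReal ((Real.pi / L) ^ 2) * ∫⁻ t, (‖w t‖₊ : ℝ≥0∞) ^ 2
      = ENNReal.ofReal ((Real.pi / L) ^ 2 * ∫ t in (0 : ℝ)..L, ‖w t‖ ^ 2) := by
        rw [hA, ENNReal.ofReal_mul (sq_nonneg _)]
    _ ≤ ENNReal.ofReal (∫ t in (0 : ℝ)..L, ‖deriv w t‖ ^ 2) := ENNReal.ofReal_le_ofReal key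
    _ ≤ _ := hB

end OneDim

/-! ### One body: coordinate lines, axes, and the box `Λ_L ⊂ ℝ³` -/

section OneBody

variable {L : ℝ}

/-- **Dirichlet Poincaré along a coordinate line.** For `f ∈ C¹(ℝ³; ℂ)` vanishing off the open
box `Λ_L` and the line `t ↦ x₀ + t e_k` with `(x₀)_k = 0`:
`(π/L)² ∫ |f(x₀ + t e_k)|² dt ≤ ∫ |∂_k f(x₀ + t e_k)|² dt` (chain rule and the interval
inequality: `t ↦ f(x₀ + t e_k)` is `C¹` and vanishes off `(0, L)`). [folklore] -/
theorem dirichlet_lintegral_line_le (hL : 0 < L) {f : Space → ℂ} (hf : ContDiff ℝ 1 f)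
    (hsupp : ∀ x ∉ box L, f x = 0) (k : Fin 3) (x₀ : Space) (hx₀ : x₀ k = 0) :
    ENNReal.ofReal ((Real.pi / L) ^ 2) *
        ∫⁻ t : ℝ, (‖f (x₀ + t • EuclideanSpace.single k (1 : ℝ))‖₊ : ℝ≥0∞) ^ 2 ≤
      ∫⁻ t : ℝ, (‖fderiv ℝ f (x₀ + t • EuclideanSpace.single k (1 : ℝ))
        (EuclideanSpace.single k (1 : ℝ))‖₊ : ℝ≥0∞) ^ 2 := by
  set v : Space := EuclideanSpace.single k (1 : ℝ) with hv
  set w : ℝ → ℂ := fun t => f (x₀ + t • v) with hw_def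
  have hw : ContDiff ℝ 1 w := hf.comp (contDiff_const.add (contDiff_id.smul contDiff_const))
  have hderiv : ∀ t, deriv w t = fderiv ℝ f (x₀ + t • v) v := by
    intro t
    have hc : HasDerivAt (fun t : ℝ => x₀ + t • v) v t := by
      simpa using ((hasDerivAt_id t).smul_const v).const_add x₀
    exact ((hf.differentiable one_ne_zero _).hasFDerivAt.comp_hasDerivAt t hc).deriv
  have hws : ∀ t ∉ Set.Ioo 0 L, w t = 0 := by
    intro t ht
    refine hsupp _ fun hx => ht ?_
    simpa [hv, hx₀] using hx k
  have h := dirichlet_lintegral_norm_sq_le hL hw hws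
  simp only [hderiv] at h
  exact h

/-- **The coordinate line through a split point**: inserting `t` at coordinate `k` of `ℝ³` is the
point with `0` inserted, translated by `t e_k`. [folklore] -/
theorem toLp_insertNth_eq_add_smul (k : Fin 3) (t : ℝ) (y : Fin 2 → ℝ) :
    (WithLp.toLp 2 (k.insertNth t y) : Space) =
      WithLp.toLp 2 (k.insertNth (0 : ℝ) y) + t • EuclideanSpace.single k (1 : ℝ) := by
  ext j
  rcases Fin.eq_self_or_eq_succAbove k j with rfl | ⟨j, rfl⟩
  · simp
  · simp [Fin.succAbove_ne]

/-- **Slicing `ℝ³` along a coordinate axis** (Tonelli along the measure-preserving split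
`ℝ³ ≃ ℝ × ℝ²`, `x ↦ (x_k, (x_j)_{j ≠ k})`, i.e. `MeasurableEquiv.toLp` followed by
`MeasurableEquiv.piFinSuccAbove`): `∫_{ℝ³} G = ∫_{ℝ²} (∫_ℝ G(y with t inserted at k) dt) dy` for
measurable `G ≥ 0`. [folklore] -/
theorem lintegral_eq_lintegral_lintegral_insertNth (k : Fin 3) {G : Space → ℝ≥0∞}
    (hG : Measurable G) :
    ∫⁻ x, G x = ∫⁻ y : Fin 2 → ℝ, ∫⁻ t : ℝ, G (WithLp.toLp 2 (k.insertNth t y)) := by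
  set e : Space ≃ᵐ ℝ × (Fin 2 → ℝ) :=
    (MeasurableEquiv.toLp 2 (Fin 3 → ℝ)).symm.trans
      (MeasurableEquiv.piFinSuccAbove (fun _ : Fin 3 => ℝ) k) with he
  have hmp : MeasurePreserving e volume (volume.prod volume) :=
    (EuclideanSpace.volume_preserving_symm_measurableEquiv_toLp (Fin 3)).trans
      (volume_preserving_piFinSuccAbove (fun _ => ℝ) k)
  have hsymm : ∀ (t : ℝ) (y : Fin 2 → ℝ), e.symm (t, y) = WithLp.toLp 2 (k.insertNth t y) :=
    fun t y => rfl
  calc ∫⁻ x, G x = ∫⁻ p, G (e.symm p) ∂(volume.prod volume) :=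
        (hmp.symm.lintegral_comp_emb e.symm.measurableEmbedding G).symm
    _ = ∫⁻ y, ∫⁻ t, G (e.symm (t, y)) :=
        lintegral_prod_symm _ (hG.comp e.symm.measurable).aemeasurable
    _ = _ := by simp only [hsymm]

/-- **Dirichlet Poincaré in one coordinate direction of the box.** For `f ∈ C¹(ℝ³; ℂ)` vanishing
off `Λ_L` and each axis `k`: `(π/L)² ∫ |f|² ≤ ∫ |∂_k f|²` (the line inequality on every line
parallel to `e_k`, integrated over the transverse coordinates). [folklore] -/
theorem dirichlet_lintegral_axis_le (hL : 0 < L) {f : Space → ℂ} (hf : ContDiff ℝ 1 f)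
    (hsupp : ∀ x ∉ box L, f x = 0) (k : Fin 3) :
    ENNReal.ofReal ((Real.pi / L) ^ 2) * ∫⁻ x, (‖f x‖₊ : ℝ≥0∞) ^ 2 ≤
      ∫⁻ x, (‖fderiv ℝ f x (EuclideanSpace.single k (1 : ℝ))‖₊ : ℝ≥0∞) ^ 2 := by
  have hG₁ : Measurable fun x => (‖f x‖₊ : ℝ≥0∞) ^ 2 :=
    hf.continuous.measurable.nnnorm.coe_nnreal_ennreal.pow_const 2
  have hG₂ : Measurable fun x =>
      (‖fderiv ℝ f x (EuclideanSpace.single k (1 : ℝ))‖₊ : ℝ≥0∞) ^ 2 :=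
    (measurable_fderiv_apply_const ℝ f _).nnnorm.coe_nnreal_ennreal.pow_const 2
  have key : ∀ y : Fin 2 → ℝ,
      ENNReal.ofReal ((Real.pi / L) ^ 2) *
          ∫⁻ t : ℝ, (‖f (WithLp.toLp 2 (k.insertNth t y))‖₊ : ℝ≥0∞) ^ 2 ≤
        ∫⁻ t : ℝ, (‖fderiv ℝ f (WithLp.toLp 2 (k.insertNth t y))
          (EuclideanSpace.single k (1 : ℝ))‖₊ : ℝ≥0∞) ^ 2 := by
    intro y
    have h := dirichlet_lintegral_line_le hL hf hsupp k (WithLp.toLp 2 (k.insertNth (0 : ℝ) y))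
      (by simp)
    simp only [← toLp_insertNth_eq_add_smul] at h
    exact h
  rw [lintegral_eq_lintegral_lintegral_insertNth k hG₁,
    lintegral_eq_lintegral_lintegral_insertNth k hG₂,
    ← lintegral_const_mul' _ _ ENNReal.ofReal_ne_top]
  exact lintegral_mono key

/-- **Sharp Dirichlet Poincaré inequality of the box `Λ_L = (0,L)³`** (the one-particle free
Dirichlet ground-state energy `3π²/L²`): for `f ∈ C¹(ℝ³; ℂ)` vanishing off `Λ_L`,
`3(π/L)² ∫ |f|² ≤ ∫ |∇f|²` (sum of the three axis inequalities). [folklore] -/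
theorem dirichlet_lintegral_box_le (hL : 0 < L) {f : Space → ℂ} (hf : ContDiff ℝ 1 f)
    (hsupp : ∀ x ∉ box L, f x = 0) :
    ENNReal.ofReal (3 * (Real.pi / L) ^ 2) * ∫⁻ x, (‖f x‖₊ : ℝ≥0∞) ^ 2 ≤ ∫⁻ x, gradSqC f x := by
  have h3 : ENNReal.ofReal (3 * (Real.pi / L) ^ 2) =
      ∑ _k : Fin 3, ENNReal.ofReal ((Real.pi / L) ^ 2) := by
    rw [Finset.sum_const, Finset.card_univ, Fintype.card_fin, nsmul_eq_mul,
      ENNReal.ofReal_mul (by norm_num), ENNReal.ofReal_ofNat, Nat.cast_ofNat]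
  have hmeas : ∀ k : Fin 3, Measurable fun x =>
      (‖fderiv ℝ f x (EuclideanSpace.single k (1 : ℝ))‖₊ : ℝ≥0∞) ^ 2 := fun k =>
    (measurable_fderiv_apply_const ℝ f _).nnnorm.coe_nnreal_ennreal.pow_const 2
  rw [h3, Finset.sum_mul]
  calc ∑ k : Fin 3, ENNReal.ofReal ((Real.pi / L) ^ 2) * ∫⁻ x, (‖f x‖₊ : ℝ≥0∞) ^ 2
      ≤ ∑ k : Fin 3, ∫⁻ x, (‖fderiv ℝ f x (EuclideanSpace.single k (1 : ℝ))‖₊ : ℝ≥0∞) ^ 2 :=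
        Finset.sum_le_sum fun k _ => dirichlet_lintegral_axis_le hL hf hsupp k
    _ = ∫⁻ x, gradSqC f x := by
        simp only [gradSqC]
        exact (lintegral_finsetSum _ fun k _ => hmeas k).symm

end OneBody

/-! ### The `N`-body bound -/

/-- **Registered stub `stub_freeDirichletGap`** (S1 of line `Sketch`, crux
stmt-AtomisticToContinuum-0827): **the sharp free Dirichlet bound** — for every `C¹` bosonic
Dirichlet trial state `Ψ` of `N` particles in `Λ_L = (0,L)³`, `L > 0`,
`energy 0 Ψ = ⟨Ψ, -ΔΨ⟩ ≥ 3N(π/L)²`. Bose symmetry moves all the kinetic energy to the first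
particle (`T = N ∫ |∇₀Ψ|²`), whose slices `x ↦ Ψ(x, Y)` are `C¹`, vanish off `Λ_L` and obey the
one-body bound `dirichlet_lintegral_box_le`; `∫ dY ∫ dx |Ψ(x, Y)|² = 1`. [folklore] -/
theorem stub_freeDirichletGap :
    ∀ (N : ℕ) (L : ℝ), 0 < L → ∀ Ψ : TrialState N L,
      ENNReal.ofReal (3 * N * (Real.pi / L) ^ 2) ≤ energy 0 Ψ := by
  intro N L hL Ψ
  cases N with
  | zero => simp
  | succ n =>
    have hcont : Continuous Ψ.ψ := Ψ.contDiff.continuous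
    have hdiff : Differentiable ℝ Ψ.ψ := Ψ.contDiff.differentiable one_ne_zero
    -- `T = N ∫ |∇₀Ψ|² = N ∫ dY ∫ dx |∇(x ↦ Ψ(x,Y))|²`
    have hT : energy 0 Ψ = (n + 1 : ℝ≥0∞) *
        ∫⁻ Y : Config n, ∫⁻ x, gradSqC (fun y => Ψ.ψ (Matrix.vecCons y Y)) x := by
      rw [← lintegral_partialGradSq_zero_eq hdiff, ← lintegral_kineticDensity_eq_mul hdiff Ψ.symm,
        energy]
      simp
    -- the one-body bound on each slice
    have hslice : ∀ Y : Config n,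
        ENNReal.ofReal (3 * (Real.pi / L) ^ 2) *
            ∫⁻ x, (‖Ψ.ψ (Matrix.vecCons x Y)‖₊ : ℝ≥0∞) ^ 2 ≤
          ∫⁻ x, gradSqC (fun y => Ψ.ψ (Matrix.vecCons y Y)) x := fun Y =>
      dirichlet_lintegral_box_le hL (contDiff_vecCons_slice Ψ.contDiff Y) fun x hx =>
        Ψ.eq_zero _ fun h => hx (by simpa using h 0)
    have hint := lintegral_mono (μ := (volume : Measure (Config n))) hslice
    -- `∫ dY ∫ dx |Ψ(x,Y)|² = 1`
    have hone : ∫⁻ Y : Config n, ENNReal.ofReal (3 * (Real.pi / L) ^ 2) *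
          ∫⁻ x, (‖Ψ.ψ (Matrix.vecCons x Y)‖₊ : ℝ≥0∞) ^ 2 =
        ENNReal.ofReal (3 * (Real.pi / L) ^ 2) := by
      have hF : Measurable fun X : Config (n + 1) => (‖Ψ.ψ X‖₊ : ℝ≥0∞) ^ 2 :=
        measurable_normSq hcont
      have hsw : AEMeasurable (Function.uncurry fun (Y : Config n) (x : Space) =>
          (‖Ψ.ψ (Matrix.vecCons x Y)‖₊ : ℝ≥0∞) ^ 2) (volume.prod volume) :=
        ((hF.comp measurable_vecCons).comp measurable_swap).aemeasurable
      rw [lintegral_const_mul' _ _ ENNReal.ofReal_ne_top, lintegral_lintegral_swap hsw,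
        lintegral_lintegral_vecCons hF, Ψ.norm_eq, mul_one]
    rw [hone] at hint
    -- multiply by `N = n + 1`
    have hN : ENNReal.ofReal (3 * ((n + 1 : ℕ) : ℝ) * (Real.pi / L) ^ 2) =
        (n + 1 : ℝ≥0∞) * ENNReal.ofReal (3 * (Real.pi / L) ^ 2) := by
      rw [show (3 : ℝ) * ((n + 1 : ℕ) : ℝ) * (Real.pi / L) ^ 2 =
          ((n + 1 : ℕ) : ℝ) * (3 * (Real.pi / L) ^ 2) by ring,
        ENNReal.ofReal_mul (Nat.cast_nonneg _), ENNReal.ofReal_natCast]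
      push_cast
      rfl
    rw [hN, hT]
    gcongr

end Summit.AtomisticToContinuum.BoseEinsteinCondensation.CoupledBaths

end
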